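import Summits.AtomisticToContinuum.HydrodynamicLimit.Theses.TwoClocks
import Summits.AtomisticToContinuum.HydrodynamicLimit.Theorems.AntiMazurCoboundariesKineticWindowGronwallRareBandDock
import Summits.AtomisticToContinuum.HydrodynamicLimit.Theorems.AntiMazurCoboundariesKineticWindowGronwallFamilyGlueCompare
import HarnessLib

/-!
# The wall in TwoClocks' vocabulary: the bounds-uniform general-`F` local node (`KineticWindowLDBoundsUniform`)
# gives the line's profile-wise product node AND TwoClocks' docking node 14442
# (line `rare-band-ladder-dock` v7, crux `KineticWindowGronwall`, stmt-AtomisticToContinuum-9282)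

Crux `Summit.AtomisticToContinuum.HydrodynamicLimit.Theses.AntiMazurCoboundaries.KineticWindowGronwall`. The v7 skeleton
isolates the kinetic wall of the crux as the PROFILE-WISE product node `LocalQuadraticWindowLDBounds` (amplitude uniform over
bounded profile classes, thresholds pointwise, all windows). This file types the same wall in the vocabulary of the TwoClocks
board items — general continuous fast one-body functionals `F(x, v)` of quadratic growth, orthogonal at every `x` under the local
Maxwellian, exactly the class of `TwoClocks.KineticWindowLDUniform` (stmt-14442) — with the two honest strengthenings every
cell/corridor proof of `TwoClocks.LocalGibbsTransfer` (stmt-14443) delivers: ONE tilt radius `β₀(θ-range, drift bound, σ)` for the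
normalised class, and the window clause `∃ τ₀ ∀ τ ≥ τ₀`. Two kernel-checked reductions:

* `localQuadraticWindowLDBounds_of_uniform` (registered helper stub `stub_boundsOfUniform`): the general-`F` node gives the
  product node — a thermal-frame product `φ(x) g((v − u(x))/√θ(x))` with `|φ| ≤ 1`, `|g w| ≤ c⋆(1 + ‖w‖²)`, `g ⊥ (1, w, ‖w‖²)`
  under the standard Gaussian is a member of the general class after normalisation by `c⋆ C₂(θm, U)` (growth transfer
  `FamilyGlue.one_add_norm_sq_frame_le`; pointwise orthogonality by the Gaussian frame change
  `KineticWindowGronwallRareBandDock.orth_localMaxwellian_of_orth`), so `c⋆ := β₀ / C₂`;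
* `kineticWindowLDUniform_of_uniform` (registered helper stub `stub_uniformDock`): the general-`F` node implies 14442 verbatim
  (bounds of the given profile from compactness of `𝕋³`, normalisation `F/C`, `β₀(F) := β₀/C`, window `τ := τ₀`).

Hence `LocalGibbsTransferPlus := EquilibriumFastWindowLD → KineticWindowLDBoundsUniform` implies BOTH the board crux 14443
(`localGibbsTransfer_of_plus`) and the line's dockable wall `LocalTransferEB` (`localTransferEB_of_plus`): the kinetic wall of
9282 is 14443 strengthened by exactly {bounds-uniform tilt radius, window clause}, and nothing else.
-/

noncomputable section

namespace Summit.AtomisticToContinuum.HydrodynamicLimit.Theorems.KineticWindowGronwallPlusNode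

open MeasureTheory Set Filter
open scoped ENNReal BigOperators
open Literature.Analysis.FluidPDE Literature.MathematicalPhysics.KineticTheory
open Summit.AtomisticToContinuum.HydrodynamicLimit.Theses.TwoClocks (EquilibriumFastWindowLD KineticWindowLDUniform
  LocalGibbsTransfer)

/-! ## §1 Statements -/

/-- The hard-sphere flow of `N+1` spheres at reduced density `σ` on `𝕋³`. -/
abbrev TFlow (σ : ℝ) (N : ℕ) : Type :=
  HardSphereFlow (Torus.geometry (Fin 3)) (hsDiameter σ N) (N + 1)

/-- The orthogonality clause of all kinetic statements of this line (verbatim the clause of `KineticFluxLdDecay`):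
`g ⊥ span{1, w, ‖w‖²}` in `L²(stdGaussian)` — the thermal-frame collision invariants. -/
def Orth (g : V3 → ℝ) : Prop :=
  ∀ (c₀ c₂ : ℝ) (b : V3), ∫ v, g v * (c₀ + inner ℝ b v + c₂ * ‖v‖ ^ 2) ∂(ProbabilityTheory.stdGaussian V3) = 0

/-- **The wall node, profile-wise** (verbatim from the skeleton v7): local quadratic-class window LD in product form,
amplitude uniform over bounded profile classes, thresholds pointwise, all windows. -/
def LocalQuadraticWindowLDBounds : Prop :=
  ∃ η₀ : ℝ, 0 < η₀ ∧ ∀ (θm θM U : ℝ), 0 < θm → θm ≤ θM → 0 ≤ U → ∀ σ : ℝ, 0 < σ →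
    ∃ cstar : ℝ, 0 < cstar ∧
    ∀ (a θ₀ : T3 → ℝ) (u₀ : T3 → V3), Continuous a → Continuous θ₀ → Continuous u₀ →
    (∀ x, 0 < a x) → (∀ x, θm ≤ θ₀ x) → (∀ x, θ₀ x ≤ θM) → (∀ x, ‖u₀ x‖ ≤ U) →
    σ ^ 3 * (⨆ x, a x) ≤ η₀ * ∫ x, a x →
    ∀ Φ : (N : ℕ) → TFlow σ N,
    ∀ (φ : T3 → ℝ) (g : V3 → ℝ), Continuous φ → Continuous g →
      (∀ x, |φ x| ≤ 1) → (∀ w, |g w| ≤ cstar * (1 + ‖w‖ ^ 2)) → Orth g →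
      ∀ ε : ℝ, 0 < ε → ∃ τ₀ : ℝ, 0 < τ₀ ∧ ∀ τ : ℝ, τ₀ ≤ τ → ∃ N₀ : ℕ, ∀ N : ℕ, N₀ ≤ N →
        ∫⁻ z, ENNReal.ofReal (Real.exp (∑ i : Fin (N + 1),
            (τ * ((N : ℝ) + 1) ^ (-(1 / 3 : ℝ)))⁻¹ *
              ∫ r in (0 : ℝ)..(τ * ((N : ℝ) + 1) ^ (-(1 / 3 : ℝ))),
                φ ((Φ N).flow r z i).1 *
                  g ((Real.sqrt (θ₀ ((Φ N).flow r z i).1))⁻¹ •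
                    (((Φ N).flow r z i).2 - u₀ ((Φ N).flow r z i).1))))
          ∂(localGibbsLaw σ a u₀ θ₀ N (Φ N)) ≤
        ENNReal.ofReal (Real.exp (ε * ((N : ℝ) + 1)))

/-- **THE WALL IN TWOCLOCKS' VOCABULARY: the bounds-uniform general-`F` local node.** The frame of
`TwoClocks.KineticWindowLDUniform` (stmt-14442: window LD for every continuous fast one-body `F(x, v)` of quadratic growth,
orthogonal at every `x` under `M_{1, u₀(x), θ₀(x)}` to `1, v_j, ‖v‖²`, from LOCAL Gibbs data with the packing guard), with two
strengthenings: the tilt radius `β₀` is chosen after a temperature range `[θm, θM]`, a drift bound `U` and `σ` but BEFORE the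
profile, the flow family and the NORMALISED observable `|F(x, v)| ≤ 1 + ‖v‖²`; and the window clause reads `∃ τ₀ ∀ τ ≥ τ₀`
(thresholds `τ₀, N₀` pointwise in everything). This is the shape a cell/corridor transfer from global equilibrium delivers
(14443 birth line, `FrozenEquilibriumCore`: ONE `β₀(θ-range, u-range, band, C)`). Conjecture-grade (open-problem). -/
def KineticWindowLDBoundsUniform : Prop :=
  ∃ η₀ : ℝ, 0 < η₀ ∧ ∀ (θm θM U : ℝ), 0 < θm → θm ≤ θM → 0 ≤ U → ∀ σ : ℝ, 0 < σ →
    ∃ β₀ : ℝ, 0 < β₀ ∧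
    ∀ (a θ₀ : T3 → ℝ) (u₀ : T3 → V3), Continuous a → Continuous θ₀ → Continuous u₀ →
    (∀ x, 0 < a x) → (∀ x, θm ≤ θ₀ x) → (∀ x, θ₀ x ≤ θM) → (∀ x, ‖u₀ x‖ ≤ U) →
    σ ^ 3 * (⨆ x, a x) ≤ η₀ * ∫ x, a x →
    ∀ Φ : (N : ℕ) → TFlow σ N,
    ∀ F : T3 × V3 → ℝ, Continuous F → (∀ y, |F y| ≤ 1 + ‖y.2‖ ^ 2) →
      (∀ x, ∫ v, F (x, v) * localMaxwellian 1 (θ₀ x) (u₀ x) v = 0) →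
      (∀ x (j : Fin 3), ∫ v, F (x, v) * v j * localMaxwellian 1 (θ₀ x) (u₀ x) v = 0) →
      (∀ x, ∫ v, F (x, v) * ‖v‖ ^ 2 * localMaxwellian 1 (θ₀ x) (u₀ x) v = 0) →
      ∀ β : ℝ, |β| ≤ β₀ → ∀ ε : ℝ, 0 < ε → ∃ τ₀ : ℝ, 0 < τ₀ ∧ ∀ τ : ℝ, τ₀ ≤ τ → ∃ N₀ : ℕ, ∀ N : ℕ, N₀ ≤ N →
        ∫⁻ z, ENNReal.ofReal (Real.exp (β * ∑ i : Fin (N + 1),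
            (τ * ((N : ℝ) + 1) ^ (-(1 / 3 : ℝ)))⁻¹ *
              ∫ r in (0 : ℝ)..(τ * ((N : ℝ) + 1) ^ (-(1 / 3 : ℝ))), F (((Φ N).flow r z) i)))
          ∂(localGibbsLaw σ a u₀ θ₀ N (Φ N)) ≤
        ENNReal.ofReal (Real.exp (ε * ((N : ℝ) + 1)))

/-- **The wall as an implication from the board crux 14440, TwoClocks vocabulary**: `EquilibriumFastWindowLD →
KineticWindowLDBoundsUniform` — TwoClocks' `LocalGibbsTransfer` (stmt-14443) strengthened by exactly {bounds-uniform tilt radius,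
window clause} (`localGibbsTransfer_of_plus`). Conjecture-grade (open-problem). -/
def LocalGibbsTransferPlus : Prop :=
  EquilibriumFastWindowLD → KineticWindowLDBoundsUniform

/-- **The dockable wall of the line** (verbatim from the skeleton v7): `EquilibriumFastWindowLD → LocalQuadraticWindowLDBounds`. -/
def LocalTransferEB : Prop :=
  EquilibriumFastWindowLD → LocalQuadraticWindowLDBounds

/-- Helper statement `BoundsOfUniform` (registered helper stub `stub_boundsOfUniform` of the line, supports 9282): the
general-`F` node gives the product node. Route-internal, not a cited fact. -/
def BoundsOfUniform : Prop :=
  KineticWindowLDBoundsUniform → LocalQuadraticWindowLDBounds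

/-- Helper statement `UniformDock` (registered helper stub `stub_uniformDock` of the line, supports 9282): the general-`F`
node gives TwoClocks' docking node `KineticWindowLDUniform` (stmt-14442) verbatim. Route-internal, not a cited fact. -/
def UniformDock : Prop :=
  KineticWindowLDBoundsUniform → KineticWindowLDUniform

/-! ## §2 Tools -/

/-- The line's `Orth` is the same term as the ladder's (through which `RareBandDock` states its frame change). -/
theorem orth_iff_ladder (g : V3 → ℝ) : Orth g ↔ KineticWindowGronwallLadder.Orth g := Iff.rfl

/-- Scaling the window functional by a constant, pointwise (no integrability needed):
`β Σᵢ w⁻¹∫₀ʷ F = Σᵢ w⁻¹∫₀ʷ (β F)`. [folklore] -/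
theorem mul_windowSum {n : ℕ} {ε : ℝ} (Φ : HardSphereFlow (Torus.geometry (Fin 3)) ε n) (F : T3 × V3 → ℝ)
    (β w : ℝ) (z : Config n (Fin 3) T3) :
    β * ∑ i, w⁻¹ * ∫ r in (0 : ℝ)..w, F (Φ.flow r z i) = ∑ i, w⁻¹ * ∫ r in (0 : ℝ)..w, β * F (Φ.flow r z i) := by
  rw [Finset.mul_sum]
  refine Finset.sum_congr rfl fun i _ => ?_
  rw [intervalIntegral.integral_const_mul]
  ring

/-- Bounds of a continuous real function on the compact torus. [folklore] -/
theorem exists_bounds_T3 {θ : T3 → ℝ} (hθ : Continuous θ) :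
    ∃ m M : ℝ, (∃ x, θ x = m) ∧ (∀ x, m ≤ θ x) ∧ (∀ x, θ x ≤ M) := by
  obtain ⟨x₀, -, hx₀⟩ := isCompact_univ.exists_isMinOn univ_nonempty hθ.continuousOn
  obtain ⟨x₁, -, hx₁⟩ := isCompact_univ.exists_isMaxOn univ_nonempty hθ.continuousOn
  exact ⟨θ x₀, θ x₁, ⟨x₀, rfl⟩, fun x => (isMinOn_iff.1 hx₀) x (mem_univ x), fun x => (isMaxOn_iff.1 hx₁) x (mem_univ x)⟩

/-! ## §3 The product node from the general-`F` node -/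

/-- **The general-`F` node gives the product node** (`stub_boundsOfUniform`): `c⋆ := β₀ / C₂(θm, U)`; the normalised member is
`F := (c⋆ C₂)⁻¹ φ(x) g((v − u(x))/√θ(x))`, of growth `≤ 1 + ‖v‖²` (`one_add_norm_sq_frame_le`) and orthogonal at every `x`
(`orth_localMaxwellian_of_orth`), run at tilt `β := c⋆ C₂ = β₀`. [folklore] -/
theorem localQuadraticWindowLDBounds_of_uniform (hU : KineticWindowLDBoundsUniform) : LocalQuadraticWindowLDBounds := by
  obtain ⟨η₀, hη₀, H⟩ := hU
  refine ⟨η₀, hη₀, fun θm θM U hθm hθmM hU0 σ hσ => ?_⟩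
  obtain ⟨β₀, hβ₀, Hβ⟩ := H θm θM U hθm hθmM hU0 σ hσ
  have hC₂ : 1 ≤ KineticWindowGronwallFamilyGlue.C₂ θm U := KineticWindowGronwallFamilyGlue.one_le_C₂ (U := U) hθm
  have hC₂0 : 0 < KineticWindowGronwallFamilyGlue.C₂ θm U := by linarith
  refine ⟨β₀ / KineticWindowGronwallFamilyGlue.C₂ θm U, div_pos hβ₀ hC₂0, ?_⟩
  intro a θ₀ u₀ ha hθ hu ha0 hθm_le hθM_ge hU_le hguard Φ φ g hφc hgc hφ1 hgb horth ε hε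
  have hθ0 : ∀ x, 0 < θ₀ x := fun x => hθm.trans_le (hθm_le x)
  -- the normalised member of the general class
  set F : T3 × V3 → ℝ := fun y => β₀⁻¹ * (φ y.1 * g ((Real.sqrt (θ₀ y.1))⁻¹ • (y.2 - u₀ y.1))) with hFdef
  have hFc : Continuous F := by
    have h1 : Continuous fun y : T3 × V3 => (Real.sqrt (θ₀ y.1))⁻¹ :=
      ((Real.continuous_sqrt.comp (hθ.comp continuous_fst)).inv₀ fun y => (Real.sqrt_pos.2 (hθ0 y.1)).ne')
    have h2 : Continuous fun y : T3 × V3 => y.2 - u₀ y.1 := continuous_snd.sub (hu.comp continuous_fst)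
    exact continuous_const.mul ((hφc.comp continuous_fst).mul (hgc.comp (h1.smul h2)))
  have hFb : ∀ y, |F y| ≤ 1 + ‖y.2‖ ^ 2 := by
    intro y
    have hg := hgb ((Real.sqrt (θ₀ y.1))⁻¹ • (y.2 - u₀ y.1))
    have hfr := KineticWindowGronwallFamilyGlue.one_add_norm_sq_frame_le hθm (hθm_le y.1) (hU_le y.1) y.2
    have h1 : |φ y.1 * g ((Real.sqrt (θ₀ y.1))⁻¹ • (y.2 - u₀ y.1))| ≤
        β₀ / KineticWindowGronwallFamilyGlue.C₂ θm U * (KineticWindowGronwallFamilyGlue.C₂ θm U * (1 + ‖y.2‖ ^ 2)) := by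
      rw [abs_mul]
      calc |φ y.1| * |g ((Real.sqrt (θ₀ y.1))⁻¹ • (y.2 - u₀ y.1))|
          ≤ 1 * (β₀ / KineticWindowGronwallFamilyGlue.C₂ θm U *
              (1 + ‖(Real.sqrt (θ₀ y.1))⁻¹ • (y.2 - u₀ y.1)‖ ^ 2)) :=
            mul_le_mul (hφ1 _) hg (abs_nonneg _) zero_le_one
        _ ≤ β₀ / KineticWindowGronwallFamilyGlue.C₂ θm U * (KineticWindowGronwallFamilyGlue.C₂ θm U * (1 + ‖y.2‖ ^ 2)) := by
            rw [one_mul]; exact mul_le_mul_of_nonneg_left hfr (div_pos hβ₀ hC₂0).le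
    have h2 : β₀ / KineticWindowGronwallFamilyGlue.C₂ θm U * (KineticWindowGronwallFamilyGlue.C₂ θm U * (1 + ‖y.2‖ ^ 2)) =
        β₀ * (1 + ‖y.2‖ ^ 2) := by
      field_simp
    rw [h2] at h1
    show |β₀⁻¹ * (φ y.1 * g ((Real.sqrt (θ₀ y.1))⁻¹ • (y.2 - u₀ y.1)))| ≤ 1 + ‖y.2‖ ^ 2
    rw [abs_mul, abs_inv, abs_of_pos hβ₀]
    calc β₀⁻¹ * |φ y.1 * g ((Real.sqrt (θ₀ y.1))⁻¹ • (y.2 - u₀ y.1))| ≤ β₀⁻¹ * (β₀ * (1 + ‖y.2‖ ^ 2)) :=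
          mul_le_mul_of_nonneg_left h1 (inv_nonneg.2 hβ₀.le)
      _ = 1 + ‖y.2‖ ^ 2 := by field_simp
  have horth' : KineticWindowGronwallLadder.Orth g := (orth_iff_ladder g).1 horth
  have hO := fun x => KineticWindowGronwallRareBandDock.orth_localMaxwellian_of_orth (hθ0 x) (u₀ x) horth' β₀⁻¹ φ x
  have hO1 : ∀ x, ∫ v, F (x, v) * localMaxwellian 1 (θ₀ x) (u₀ x) v = 0 := fun x => (hO x).1
  have hO2 : ∀ x (j : Fin 3), ∫ v, F (x, v) * v j * localMaxwellian 1 (θ₀ x) (u₀ x) v = 0 := fun x j => (hO x).2.1 j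
  have hO3 : ∀ x, ∫ v, F (x, v) * ‖v‖ ^ 2 * localMaxwellian 1 (θ₀ x) (u₀ x) v = 0 := fun x => (hO x).2.2
  -- run the node at tilt `β₀`
  obtain ⟨τ₀, hτ₀, Hτ⟩ := Hβ a θ₀ u₀ ha hθ hu ha0 hθm_le hθM_ge hU_le hguard Φ F hFc hFb hO1 hO2 hO3 β₀
    (by rw [abs_of_pos hβ₀]) ε hε
  refine ⟨τ₀, hτ₀, fun τ hτ => ?_⟩
  obtain ⟨N₀, HN⟩ := Hτ τ hτ
  refine ⟨N₀, fun N hN => ?_⟩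
  have h := HN N hN
  refine le_of_eq_of_le (lintegral_congr fun z => ?_) h
  rw [mul_windowSum]
  congr 2
  refine Finset.sum_congr rfl fun i _ => ?_
  congr 1
  refine intervalIntegral.integral_congr fun r _ => ?_
  simp only [hFdef]
  field_simp

/-- **Registered helper stub `stub_boundsOfUniform`**: `BoundsOfUniform` holds. [folklore] -/
theorem stub_boundsOfUniform : BoundsOfUniform :=
  localQuadraticWindowLDBounds_of_uniform

/-! ## §4 TwoClocks' docking node 14442 from the general-`F` node -/

/-- **The general-`F` node gives `TwoClocks.KineticWindowLDUniform` verbatim** (`stub_uniformDock`): bounds of the given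
profile by compactness of `𝕋³`; normalise `F` by `C' := max C 1`; tilt radius `β₀ / C'`; window `τ := τ₀`. [folklore] -/
theorem kineticWindowLDUniform_of_uniform (hU : KineticWindowLDBoundsUniform) : KineticWindowLDUniform := by
  obtain ⟨η₀, hη₀, H⟩ := hU
  refine ⟨η₀, hη₀, ?_⟩
  intro a θ₀ u₀ ha hθ hu ha0 hθ0 σ hσ hguard Φ F hFc hFC hO1 hO2 hO3
  -- bounds of the profile
  obtain ⟨θm, θM, ⟨xm, hxm⟩, hθm_le, hθM_ge⟩ := exists_bounds_T3 hθ
  have hθm : 0 < θm := hxm ▸ hθ0 xm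
  have hθmM : θm ≤ θM := (hθm_le xm).trans (hθM_ge xm)
  obtain ⟨-, U, -, -, hU_le⟩ := exists_bounds_T3 hu.norm
  have hU0 : 0 ≤ U := (norm_nonneg _).trans (hU_le 0)
  obtain ⟨β₀, hβ₀, Hβ⟩ := H θm θM U hθm hθmM hU0 σ hσ
  -- normalisation of the observable
  obtain ⟨C, hC⟩ := hFC
  set C' : ℝ := max C 1 with hC'def
  have hC'1 : 1 ≤ C' := le_max_right _ _
  have hC'0 : 0 < C' := by positivity
  have hCC' : C ≤ C' := le_max_left _ _
  set F' : T3 × V3 → ℝ := fun y => C'⁻¹ * F y with hF'def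
  have hF'c : Continuous F' := continuous_const.mul hFc
  have hF'b : ∀ y, |F' y| ≤ 1 + ‖y.2‖ ^ 2 := by
    intro y
    simp only [hF'def, abs_mul, abs_inv, abs_of_pos hC'0]
    have h1 : |F y| ≤ C' * (1 + ‖y.2‖ ^ 2) := (hC y).trans (mul_le_mul_of_nonneg_right hCC' (by positivity))
    calc C'⁻¹ * |F y| ≤ C'⁻¹ * (C' * (1 + ‖y.2‖ ^ 2)) := mul_le_mul_of_nonneg_left h1 (inv_nonneg.2 hC'0.le)
      _ = 1 + ‖y.2‖ ^ 2 := by field_simp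
  have hO1' : ∀ x, ∫ v, F' (x, v) * localMaxwellian 1 (θ₀ x) (u₀ x) v = 0 := by
    intro x
    have e : (fun v => F' (x, v) * localMaxwellian 1 (θ₀ x) (u₀ x) v) =
        fun v => C'⁻¹ * (F (x, v) * localMaxwellian 1 (θ₀ x) (u₀ x) v) := by
      funext v; simp only [hF'def]; ring
    rw [e, integral_const_mul, hO1 x, mul_zero]
  have hO2' : ∀ x (j : Fin 3), ∫ v, F' (x, v) * v j * localMaxwellian 1 (θ₀ x) (u₀ x) v = 0 := by
    intro x j
    have e : (fun v => F' (x, v) * v j * localMaxwellian 1 (θ₀ x) (u₀ x) v) =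
        fun v => C'⁻¹ * (F (x, v) * v j * localMaxwellian 1 (θ₀ x) (u₀ x) v) := by
      funext v; simp only [hF'def]; ring
    rw [e, integral_const_mul, hO2 x j, mul_zero]
  have hO3' : ∀ x, ∫ v, F' (x, v) * ‖v‖ ^ 2 * localMaxwellian 1 (θ₀ x) (u₀ x) v = 0 := by
    intro x
    have e : (fun v => F' (x, v) * ‖v‖ ^ 2 * localMaxwellian 1 (θ₀ x) (u₀ x) v) =
        fun v => C'⁻¹ * (F (x, v) * ‖v‖ ^ 2 * localMaxwellian 1 (θ₀ x) (u₀ x) v) := by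
      funext v; simp only [hF'def]; ring
    rw [e, integral_const_mul, hO3 x, mul_zero]
  -- tilt radius `β₀ / C'`, window `τ := τ₀`
  refine ⟨β₀ / C', div_pos hβ₀ hC'0, fun β hβ ε hε => ?_⟩
  have hβ' : |β * C'| ≤ β₀ := by
    rw [abs_mul, abs_of_pos hC'0]
    calc |β| * C' ≤ β₀ / C' * C' := mul_le_mul_of_nonneg_right hβ hC'0.le
      _ = β₀ := div_mul_cancel₀ β₀ hC'0.ne'
  obtain ⟨τ₀, hτ₀, Hτ⟩ := Hβ a θ₀ u₀ ha hθ hu ha0 hθm_le hθM_ge hU_le hguard Φ F' hF'c hF'b hO1' hO2' hO3' (β * C')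
    hβ' ε hε
  obtain ⟨N₀, HN⟩ := Hτ τ₀ le_rfl
  refine ⟨τ₀, hτ₀, N₀, fun N hN => ?_⟩
  have h := HN N hN
  refine le_of_eq_of_le (lintegral_congr fun z => ?_) h
  rw [mul_windowSum (Φ N) F β, mul_windowSum (Φ N) F' (β * C')]
  congr 2
  refine Finset.sum_congr rfl fun i _ => ?_
  congr 1
  refine intervalIntegral.integral_congr fun r _ => ?_
  simp only [hF'def]
  field_simp

/-- **Registered helper stub `stub_uniformDock`**: `UniformDock` holds. [folklore] -/
theorem stub_uniformDock : UniformDock :=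
  kineticWindowLDUniform_of_uniform

/-! ## §5 Consequences: the Plus transfer implies the board crux 14443 and the line's dockable wall -/

/-- `LocalGibbsTransferPlus → TwoClocks.LocalGibbsTransfer` (stmt-14443): the wall in TwoClocks' vocabulary is a STRENGTHENING of
the board crux. -/
theorem localGibbsTransfer_of_plus (h : LocalGibbsTransferPlus) : LocalGibbsTransfer :=
  fun hE => kineticWindowLDUniform_of_uniform (h hE)

/-- `LocalGibbsTransferPlus → LocalTransferEB`: the wall in TwoClocks' vocabulary implies the line's dockable wall. -/
theorem localTransferEB_of_plus (h : LocalGibbsTransferPlus) : LocalTransferEB :=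
  fun hE => localQuadraticWindowLDBounds_of_uniform (h hE)

/-! ## §6 (v2, appended) The pointwise comparison of GENERAL fast functionals between two nearby family members -/

/-- **Pointwise three-piece comparison for general one-body functionals** between two nearby family members (bulk
modulus `η` on `‖v‖ ≤ U + √θM R`, quadratic envelopes `C'`, tail weight `t = t₀ + α + γ‖·‖²` read in the primed frame):
`2 (β F) ≤ 3⁻¹ (6 (β F') + 6 (b η + 2 b C' C₃ ηt (1 + C₂)) (1 + ‖v‖²) + 12 b C' C₃ t₀(w̃'))`. [folklore] -/
theorem general_compare_avg {θm θM U θ' C' η ηt b β R α γ Fv F'v : ℝ} (hθm : 0 < θm) (hθ' : θm ≤ θ') (hθM' : θ' ≤ θM)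
    {u' : V3} (hu' : ‖u'‖ ≤ U) (hβ : |β| ≤ b) (hη : 0 ≤ η) (hC' : 0 ≤ C') (hR : 0 ≤ R) {v : V3}
    (hbulk : ‖v‖ ≤ U + Real.sqrt θM * R → |Fv - F'v| ≤ η) (hF : |Fv| ≤ C' * (1 + ‖v‖ ^ 2))
    (hF' : |F'v| ≤ C' * (1 + ‖v‖ ^ 2))
    {t t₀ : V3 → ℝ} (ht0 : ∀ w, 0 ≤ t w) (htR : ∀ w, R ≤ ‖w‖ → t w = 1 + ‖w‖ ^ 2)
    (hsplit : ∀ w, t w = t₀ w + (α + γ * ‖w‖ ^ 2)) (hα : |α| ≤ ηt) (hγ : |γ| ≤ ηt) :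
    2 * (β * Fv) ≤
      (3 : ℝ)⁻¹ * (6 * (β * F'v) +
        6 * (b * η + 2 * b * C' * KineticWindowGronwallFamilyGlue.C₃ θM U * ηt *
              (1 + KineticWindowGronwallFamilyGlue.C₂ θm U)) * (1 + ‖v‖ ^ 2) +
        12 * b * C' * KineticWindowGronwallFamilyGlue.C₃ θM U * t₀ ((Real.sqrt θ')⁻¹ • (v - u'))) := by
  set W' : V3 := (Real.sqrt θ')⁻¹ • (v - u') with hW'
  have hθ0' : 0 < θ' := hθm.trans_le hθ'
  have hC₂ : 1 ≤ KineticWindowGronwallFamilyGlue.C₂ θm U := KineticWindowGronwallFamilyGlue.one_le_C₂ (U := U) hθm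
  have hC₃ : 1 ≤ KineticWindowGronwallFamilyGlue.C₃ θM U :=
    KineticWindowGronwallFamilyGlue.one_le_C₃ (U := U) (hθ0'.trans_le hθM')
  have hb : 0 ≤ b := (abs_nonneg β).trans hβ
  have hηt : 0 ≤ ηt := (abs_nonneg α).trans hα
  have hv2 : 0 ≤ 1 + ‖v‖ ^ 2 := by positivity
  have hgW' : 1 + ‖W'‖ ^ 2 ≤ KineticWindowGronwallFamilyGlue.C₂ θm U * (1 + ‖v‖ ^ 2) :=
    KineticWindowGronwallFamilyGlue.one_add_norm_sq_frame_le hθm hθ' hu' v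
  have hvW' : 1 + ‖v‖ ^ 2 ≤ KineticWindowGronwallFamilyGlue.C₃ θM U * (1 + ‖W'‖ ^ 2) :=
    KineticWindowGronwallFamilyGlue.one_add_norm_sq_le_frame hθ0' hθM' hu' v
  have h1 : 2 * (β * Fv) ≤ 2 * (β * F'v) + 2 * b * |Fv - F'v| := by
    have : β * (Fv - F'v) ≤ |β| * |Fv - F'v| := by
      rw [← abs_mul]; exact le_abs_self _
    have : |β| * |Fv - F'v| ≤ b * |Fv - F'v| := mul_le_mul_of_nonneg_right hβ (abs_nonneg _)
    nlinarith
  have h2 : |Fv - F'v| ≤ η + 2 * C' * KineticWindowGronwallFamilyGlue.C₃ θM U * t W' := by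
    have hK : 0 ≤ 2 * C' * KineticWindowGronwallFamilyGlue.C₃ θM U := by
      have : 0 ≤ KineticWindowGronwallFamilyGlue.C₃ θM U := by linarith
      positivity
    by_cases hb' : ‖v‖ ≤ U + Real.sqrt θM * R
    · have := hbulk hb'
      have := mul_nonneg hK (ht0 W')
      linarith
    · push Not at hb'
      have hRW' : R ≤ ‖W'‖ := KineticWindowGronwallFamilyGlue.le_norm_frame_of_lt hθ0' hθM' hu' hR hb'
      rw [htR W' hRW']
      have hd : |Fv - F'v| ≤ 2 * (C' * (1 + ‖v‖ ^ 2)) := by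
        have := abs_sub Fv F'v; linarith
      have : C' * (1 + ‖v‖ ^ 2) ≤ C' * (KineticWindowGronwallFamilyGlue.C₃ θM U * (1 + ‖W'‖ ^ 2)) :=
        mul_le_mul_of_nonneg_left hvW' hC'
      nlinarith
  have hrem : α + γ * ‖W'‖ ^ 2 ≤ ηt * (1 + KineticWindowGronwallFamilyGlue.C₂ θm U) * (1 + ‖v‖ ^ 2) := by
    have e1 : α ≤ ηt := (le_abs_self α).trans hα
    have e2 : γ * ‖W'‖ ^ 2 ≤ ηt * ‖W'‖ ^ 2 := mul_le_mul_of_nonneg_right ((le_abs_self γ).trans hγ) (sq_nonneg _)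
    have e3 : ‖W'‖ ^ 2 ≤ KineticWindowGronwallFamilyGlue.C₂ θm U * (1 + ‖v‖ ^ 2) := by nlinarith [sq_nonneg ‖W'‖]
    have e4 : ηt * ‖W'‖ ^ 2 ≤ ηt * (KineticWindowGronwallFamilyGlue.C₂ θm U * (1 + ‖v‖ ^ 2)) :=
      mul_le_mul_of_nonneg_left e3 hηt
    have e5 : ηt ≤ ηt * (1 + ‖v‖ ^ 2) := by nlinarith [sq_nonneg ‖v‖]
    nlinarith
  set P : ℝ := 1 + ‖v‖ ^ 2 with hP
  set T : ℝ := t₀ W' with hT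
  set D : ℝ := |Fv - F'v| with hD
  set K : ℝ := C' * KineticWindowGronwallFamilyGlue.C₃ θM U with hK
  set M : ℝ := ηt * (1 + KineticWindowGronwallFamilyGlue.C₂ θm U) with hM
  have hK0 : 0 ≤ K := by
    have : 0 ≤ KineticWindowGronwallFamilyGlue.C₃ θM U := by linarith
    positivity
  have htt : t W' = T + (α + γ * ‖W'‖ ^ 2) := hsplit W'
  have hP1 : 1 ≤ P := by rw [hP]; nlinarith [sq_nonneg ‖v‖]
  have s2 : t W' ≤ T + M * P := by rw [htt, hM]; linarith
  have s1 : b * D ≤ b * η + 2 * (b * K) * (T + M * P) := by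
    have h2' : D ≤ η + 2 * K * t W' := by rw [hK]; linarith [h2]
    have := mul_le_mul_of_nonneg_left h2' hb
    have h3 : b * (2 * K * t W') ≤ b * (2 * K * (T + M * P)) :=
      mul_le_mul_of_nonneg_left (mul_le_mul_of_nonneg_left s2 (by positivity)) hb
    nlinarith
  have s3 : b * η ≤ b * η * P := le_mul_of_one_le_right (mul_nonneg hb hη) hP1
  have eR : (3 : ℝ)⁻¹ * (6 * (β * F'v) + 6 * (b * η + 2 * b * C' * KineticWindowGronwallFamilyGlue.C₃ θM U * ηt *
        (1 + KineticWindowGronwallFamilyGlue.C₂ θm U)) * P + 12 * b * C' * KineticWindowGronwallFamilyGlue.C₃ θM U * T) =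
      2 * (β * F'v) + 2 * (b * η * P) + 4 * (b * K * M * P) + 4 * (b * K * T) := by
    rw [hK, hM]; ring
  have eS : 2 * (b * K) * (T + M * P) = 2 * (b * K * T) + 2 * (b * K * M * P) := by ring
  rw [eR]
  rw [eS] at s1
  have hKMP : 0 ≤ b * K * M * P := by
    have : 0 ≤ M := by rw [hM]; positivity
    positivity
  linarith [h1, s1, s3, hKMP]

/-- Helper statement `GeneralCompareAvg` (registered helper stub `stub_generalCompareAvg`, v2 of this file): the closed form of
`general_compare_avg`. Route-internal, not a cited fact. -/
def GeneralCompareAvg : Prop :=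
  ∀ (θm θM U θ' C' η ηt b β R α γ Fv F'v : ℝ) (u' v : V3) (t t₀ : V3 → ℝ),
    0 < θm → θm ≤ θ' → θ' ≤ θM → ‖u'‖ ≤ U → |β| ≤ b → 0 ≤ η → 0 ≤ C' → 0 ≤ R →
    (‖v‖ ≤ U + Real.sqrt θM * R → |Fv - F'v| ≤ η) → |Fv| ≤ C' * (1 + ‖v‖ ^ 2) → |F'v| ≤ C' * (1 + ‖v‖ ^ 2) →
    (∀ w, 0 ≤ t w) → (∀ w, R ≤ ‖w‖ → t w = 1 + ‖w‖ ^ 2) → (∀ w, t w = t₀ w + (α + γ * ‖w‖ ^ 2)) →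
    |α| ≤ ηt → |γ| ≤ ηt →
    2 * (β * Fv) ≤
      (3 : ℝ)⁻¹ * (6 * (β * F'v) +
        6 * (b * η + 2 * b * C' * KineticWindowGronwallFamilyGlue.C₃ θM U * ηt *
              (1 + KineticWindowGronwallFamilyGlue.C₂ θm U)) * (1 + ‖v‖ ^ 2) +
        12 * b * C' * KineticWindowGronwallFamilyGlue.C₃ θM U * t₀ ((Real.sqrt θ')⁻¹ • (v - u')))

/-- **Registered helper stub `stub_generalCompareAvg`** (v2): `GeneralCompareAvg` holds (`general_compare_avg`). [folklore] -/
theorem stub_generalCompareAvg : GeneralCompareAvg :=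
  fun _ _ _ _ _ _ _ _ _ _ _ _ _ _ _ _ _ _ hθm hθ' hθM' hu' hβ hη hC' hR hbulk hF hF' ht0 htR hsplit hα hγ =>
    general_compare_avg hθm hθ' hθM' hu' hβ hη hC' hR hbulk hF hF' ht0 htR hsplit hα hγ

end Summit.AtomisticToContinuum.HydrodynamicLimit.Theorems.KineticWindowGronwallPlusNode

end
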